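import Literature.NumberTheory.NumberFields.QuadraticTwistIntersection
import Literature.NumberTheory.NumberFields.PositiveInvolutionCM
import HarnessLib

/-!
# The quadratic twist `τ(L)(i√p) ⊆ ℂ` of a CM field is a CM number field

Topic `NumberTheory/NumberFields`; namespace `Literature.NumberTheory.NumberFields`.  THEOREMS ONLY (no definition, no named fact, no
instance — the CM structure is delivered as a theorem `isCMField_…`, to be `haveI`-ed by the consumer).  Cell hodgecm-mathlib, binder `hDel`
(crux `HDel` = stmt-HodgeConjecture-24835), cut of record v12 «K-TWIST», piece P2 (a)(b): the torus field `M = τ(L)(i√p)` of the twisted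
auxiliary datum `(U(H) × T₀(M), X × {h_{Φ_M}})` of [Deligne1979ShimuraVarieties] 2.3.9–2.3.10 must be a CM number field for B-typ04's
`Aux.canonicalModel_exists_ext_printed` to apply (`[NumberField M] [IsCMField M]`).  HC_CM is proved only modulo the 7 printed citations
until rung 0 closes; nothing here discharges a binder.

## What is proved

For a CM number field `L`, `τ : L →+* ℂ`, `p : ℕ`, and `E := τ(L) ⊔ ℚ(i√p)` (`τ.toRatAlgHom.fieldRange ⊔ ℚ⟮twistRoot p⟯`):
* `finiteDimensional_fieldRange_sup_adjoin_twistRoot` — `E/ℚ` is finite; `apply_mem_fieldRange_sup_adjoin_twistRoot` (`τ(L) ⊆ E`),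
  `twistRoot_mem_fieldRange_sup_adjoin_twistRoot`;
* `conj_mem_fieldRange_sup_adjoin_twistRoot` — `E` is stable under complex conjugation (`z = a + b·i√p`, `a, b ∈ τ(L)`, and `τ(L)` is
  conj-stable because `L` is CM: `conj ∘ τ = τ ∘ c_L`);
* **`isCMField_fieldRange_sup_adjoin_twistRoot`** — `E` is a CM field: complex conjugation restricts to an automorphism `σ ≠ 1` of `E`
  (`σ(i√p) = -i√p`, `p ≠ 0`) with `φ ∘ σ = conj ∘ φ` for EVERY embedding `φ : E → ℂ` (checked on `τ(L)` by
  `IsCMField.complexEmbedding_complexConj` for the embedding `φ ∘ τ` of `L`, and on `i√p` by `φ(i√p)² = -p`), so Shimura's criterion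
  [Shimura1998] §18.2 Lemma (i) (tree `IsCMField.of_forall_isConj_of_ne_one`) applies;
* `twistRootElem` bookkeeping as theorems: the element `⟨i√p, _⟩ ∈ E` squares to `-p` (`twistRoot_mul_self_subtype`).

## References
* [Shimura1998] G. Shimura, *Abelian Varieties with Complex Multiplication and Modular Functions* (1998), §18.2 Lemma (i) (p. 127).
* [Deligne1979ShimuraVarieties] P. Deligne, *Variétés de Shimura*, PSPM 33.2 (1979), 2.3.9–2.3.10 (Milne's transl. p. 32).
* [Lang2002] S. Lang, *Algebra*, Ch. V §1.
-/

set_option autoImplicit false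

noncomputable section

open IntermediateField NumberField NumberField.ComplexEmbedding
open scoped ComplexConjugate

namespace Literature.NumberTheory.NumberFields

variable {L : Type} [Field L] [NumberField L] [IsCMField L] (τ : L →+* ℂ) (p : ℕ)

/-! ### §1. The compositum `E = τ(L) ⊔ ℚ(i√p)`: finiteness and generators -/

omit [IsCMField L] in
/-- `E = τ(L)(i√p)` is finite over `ℚ` (`τ(L) ≅ L` and `ℚ(i√p)` are). [cite: Lang2002, Ch. V §1 Prop. 1.4] -/
theorem finiteDimensional_fieldRange_sup_adjoin_twistRoot :
    FiniteDimensional ℚ ↥(τ.toRatAlgHom.fieldRange ⊔ IntermediateField.adjoin ℚ {twistRoot p}) := by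
  haveI : FiniteDimensional ℚ ↥τ.toRatAlgHom.fieldRange :=
    LinearEquiv.finiteDimensional (AlgEquiv.ofInjectiveField τ.toRatAlgHom).toLinearEquiv
  have hri : IsIntegral ℚ (twistRoot p) := by
    refine ⟨Polynomial.X ^ 2 + Polynomial.C (p : ℚ), Polynomial.monic_X_pow_add_C _ two_ne_zero, ?_⟩
    simp [sq, twistRoot_mul_self]
  haveI : FiniteDimensional ℚ ↥(IntermediateField.adjoin ℚ {twistRoot p}) := IntermediateField.adjoin.finiteDimensional hri
  exact IntermediateField.finiteDimensional_sup _ _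

omit [IsCMField L] in
/-- `τ(x) ∈ E`. [cite: Lang2002, Ch. V §1 Prop. 1.4] -/
theorem apply_mem_fieldRange_sup_adjoin_twistRoot (x : L) :
    τ x ∈ τ.toRatAlgHom.fieldRange ⊔ IntermediateField.adjoin ℚ {twistRoot p} :=
  (le_sup_left : τ.toRatAlgHom.fieldRange ≤ _) (AlgHom.mem_fieldRange.2 ⟨x, rfl⟩)

omit [IsCMField L] in
/-- `i√p ∈ E`. [cite: Lang2002, Ch. V §1 Prop. 1.4] -/
theorem twistRoot_mem_fieldRange_sup_adjoin_twistRoot :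
    twistRoot p ∈ τ.toRatAlgHom.fieldRange ⊔ IntermediateField.adjoin ℚ {twistRoot p} :=
  (le_sup_right : IntermediateField.adjoin ℚ {twistRoot p} ≤ _) (IntermediateField.mem_adjoin_simple_self ℚ _)

omit [IsCMField L] in
/-- The element `i√p ∈ E` squares to `-p` in `E`. [cite: Lang2002, Ch. V §1 Example 1] -/
theorem twistRoot_mul_self_subtype :
    (⟨twistRoot p, twistRoot_mem_fieldRange_sup_adjoin_twistRoot τ p⟩ :
        ↥(τ.toRatAlgHom.fieldRange ⊔ IntermediateField.adjoin ℚ {twistRoot p})) *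
      ⟨twistRoot p, twistRoot_mem_fieldRange_sup_adjoin_twistRoot τ p⟩ =
      -(p : ↥(τ.toRatAlgHom.fieldRange ⊔ IntermediateField.adjoin ℚ {twistRoot p})) := by
  apply Subtype.ext
  push_cast
  exact twistRoot_mul_self p

/-! ### §2. Conjugation stability -/

/-- `conj (i√p) = -i√p`. [cite: Lang2002, Ch. V §1 Example 1] -/
theorem conj_twistRoot : conj (twistRoot p) = -twistRoot p := by
  apply Complex.ext <;> simp [twistRoot]

/-- `conj (τ x) = τ (c_L x) ∈ τ(L)`: the image of a CM field is conj-stable. [cite: Shimura1998, §18.2 Lemma (i)] -/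
theorem conj_apply_mem_fieldRange (x : L) : conj (τ x) ∈ τ.toRatAlgHom.fieldRange :=
  AlgHom.mem_fieldRange.2 ⟨IsCMField.complexConj L x, (IsCMField.complexEmbedding_complexConj (K := L) τ x)⟩

/-- **`E = τ(L)(i√p)` is stable under complex conjugation**: `conj(a + b·i√p) = conj a - conj b · i√p` with `conj a, conj b ∈ τ(L)`.
[cite: Shimura1998, §18.2 Lemma (i)] -/
theorem conj_mem_fieldRange_sup_adjoin_twistRoot {z : ℂ}
    (hz : z ∈ τ.toRatAlgHom.fieldRange ⊔ IntermediateField.adjoin ℚ {twistRoot p}) :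
    conj z ∈ τ.toRatAlgHom.fieldRange ⊔ IntermediateField.adjoin ℚ {twistRoot p} := by
  obtain ⟨a, ha, b, hb, rfl⟩ :=
    exists_add_mul_of_mem_sup_adjoin τ.toRatAlgHom.fieldRange (twistRoot_mul_self_mem p _) hz
  obtain ⟨x, rfl⟩ := AlgHom.mem_fieldRange.1 ha
  obtain ⟨y, rfl⟩ := AlgHom.mem_fieldRange.1 hb
  rw [map_add, map_mul, conj_twistRoot, mul_neg]
  refine add_mem ((le_sup_left : τ.toRatAlgHom.fieldRange ≤ _) (conj_apply_mem_fieldRange τ x))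
    (neg_mem (mul_mem ((le_sup_left : τ.toRatAlgHom.fieldRange ≤ _) (conj_apply_mem_fieldRange τ y))
      (twistRoot_mem_fieldRange_sup_adjoin_twistRoot τ p)))

omit [NumberField L] [IsCMField L] in
/-- A ring homomorphism sends a square root of `-p` to `±i√p`. [folklore] -/
private theorem apply_eq_or_eq_neg_twistRoot {M : Type} [Field M] (φ : M →+* ℂ) {w : M} (hw : w * w = -(p : M)) :
    φ w = twistRoot p ∨ φ w = -twistRoot p := by
  have h : φ w * φ w = twistRoot p * twistRoot p := by rw [← map_mul, hw, twistRoot_mul_self, map_neg, map_natCast]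
  have h' : (φ w - twistRoot p) * (φ w + twistRoot p) = 0 := by linear_combination h
  rcases mul_eq_zero.1 h' with h1 | h1
  · exact Or.inl (sub_eq_zero.1 h1)
  · exact Or.inr (eq_neg_of_add_eq_zero_left h1)

/-! ### §3. `E` is a CM field -/

/-- **The quadratic twist `E = τ(L)(i√p)` of a CM field is a CM field** (`p ≠ 0`): complex conjugation restricts to an automorphism
`σ ≠ 1` of `E` with `φ ∘ σ = conj ∘ φ` for every embedding `φ : E → ℂ`, so [Shimura1998] §18.2 Lemma (i) applies
(tree `IsCMField.of_forall_isConj_of_ne_one`). [cite: Shimura1998, §18.2 Lemma (i) (p. 127)] [cite: Deligne1979ShimuraVarieties, 2.3.9–2.3.10] -/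
theorem isCMField_fieldRange_sup_adjoin_twistRoot (hp : p ≠ 0) :
    haveI : FiniteDimensional ℚ ↥(τ.toRatAlgHom.fieldRange ⊔ IntermediateField.adjoin ℚ {twistRoot p}) :=
      finiteDimensional_fieldRange_sup_adjoin_twistRoot τ p
    IsCMField ↥(τ.toRatAlgHom.fieldRange ⊔ IntermediateField.adjoin ℚ {twistRoot p}) := by
  set E := τ.toRatAlgHom.fieldRange ⊔ IntermediateField.adjoin ℚ {twistRoot p} with hE
  haveI : FiniteDimensional ℚ ↥E := finiteDimensional_fieldRange_sup_adjoin_twistRoot τ p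
  haveI : NumberField ↥E := NumberField.mk
  -- complex conjugation restricted to `E`
  let σr : ↥E ≃+* ↥E :=
    { toFun := fun z => ⟨conj (z : ℂ), conj_mem_fieldRange_sup_adjoin_twistRoot τ p z.2⟩
      invFun := fun z => ⟨conj (z : ℂ), conj_mem_fieldRange_sup_adjoin_twistRoot τ p z.2⟩
      left_inv := fun z => Subtype.ext (Complex.conj_conj (z : ℂ))
      right_inv := fun z => Subtype.ext (Complex.conj_conj (z : ℂ))
      map_mul' := fun z w => Subtype.ext (map_mul _ _ _)
      map_add' := fun z w => Subtype.ext (map_add _ _ _) }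
  have hσr : ∀ z : ↥E, ((σr z : ↥E) : ℂ) = conj (z : ℂ) := fun z => rfl
  let σ : ↥E ≃ₐ[ℚ] ↥E := AlgEquiv.ofRingEquiv (f := σr) fun q => by
    apply Subtype.ext
    rw [hσr, eq_ratCast, SubfieldClass.coe_ratCast, ← Complex.ofReal_ratCast, Complex.conj_ofReal]
  have hσ : ∀ z : ↥E, ((σ z : ↥E) : ℂ) = conj (z : ℂ) := fun z => rfl
  -- `σ ≠ 1`: it moves `i√p`
  have hne : σ ≠ 1 := by
    intro h
    have h1 : ((σ ⟨twistRoot p, twistRoot_mem_fieldRange_sup_adjoin_twistRoot τ p⟩ : ↥E) : ℂ) = twistRoot p := by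
      rw [h, AlgEquiv.one_apply]
    rw [hσ] at h1
    change conj (twistRoot p) = twistRoot p at h1
    rw [conj_twistRoot] at h1
    have h2 : twistRoot p = 0 := by
      have : (2 : ℂ) * twistRoot p = 0 := by linear_combination -h1
      simpa using this
    have h3 := congrArg Complex.im h2
    simp only [twistRoot, Complex.mul_im, Complex.I_re, Complex.ofReal_im, mul_zero, Complex.I_im, Complex.ofReal_re,
      one_mul, zero_add, Complex.zero_im] at h3
    exact hp (by exact_mod_cast (Real.sqrt_eq_zero (Nat.cast_nonneg p)).1 h3)
  -- `φ ∘ σ = conj ∘ φ` for every embedding `φ`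
  have hconj : ∀ φ : ↥E →+* ℂ, IsConj φ σ := by
    intro φ
    -- `τ` corestricted to `E`, and the element `w = i√p ∈ E`
    let j : L →+* ↥E :=
      { toFun := fun x => ⟨τ x, apply_mem_fieldRange_sup_adjoin_twistRoot τ p x⟩
        map_one' := Subtype.ext (map_one τ)
        map_mul' := fun x y => Subtype.ext (map_mul τ x y)
        map_zero' := Subtype.ext (map_zero τ)
        map_add' := fun x y => Subtype.ext (map_add τ x y) }
    have hj : ∀ x : L, ((j x : ↥E) : ℂ) = τ x := fun x => rfl
    let w : ↥E := ⟨twistRoot p, twistRoot_mem_fieldRange_sup_adjoin_twistRoot τ p⟩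
    have hw : w * w = -(p : ↥E) := twistRoot_mul_self_subtype τ p
    -- `σ ∘ j = j ∘ c_L`, `σ w = -w`
    have hσj : ∀ x : L, σ (j x) = j (IsCMField.complexConj L x) := fun x =>
      Subtype.ext (by rw [hσ, hj, hj]; exact (IsCMField.complexEmbedding_complexConj (K := L) τ x).symm)
    have hσw : σ w = -w := Subtype.ext (by rw [hσ]; push_cast; exact conj_twistRoot p)
    -- `conj ∘ (φ ∘ j) = (φ ∘ j) ∘ c_L` (`L` is CM) and `conj (φ w) = φ (-w)` (`φ w = ±i√p`)
    have hψ : ∀ x : L, conj (φ (j x)) = φ (j (IsCMField.complexConj L x)) := fun x =>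
      (IsCMField.complexEmbedding_complexConj (K := L) (φ.comp j) x).symm
    have hφw : conj (φ w) = φ (-w) := by
      rw [map_neg]
      rcases apply_eq_or_eq_neg_twistRoot p φ hw with h | h
      · rw [h, conj_twistRoot]
      · rw [h, map_neg, conj_twistRoot, neg_neg]
    -- check `conj (φ z) = φ (σ z)` on `z = j x + j y · w`
    refine RingHom.ext fun z => ?_
    obtain ⟨a, ha, b, hb, hz⟩ :=
      exists_add_mul_of_mem_sup_adjoin τ.toRatAlgHom.fieldRange (twistRoot_mul_self_mem p _) z.2
    obtain ⟨x, rfl⟩ := AlgHom.mem_fieldRange.1 ha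
    obtain ⟨y, rfl⟩ := AlgHom.mem_fieldRange.1 hb
    have hzE : z = j x + j y * w := Subtype.ext (by push_cast; rw [hj, hj]; exact hz)
    change conj (φ z) = φ (σ z)
    rw [hzE, map_add, map_mul, map_add, map_mul, map_add, map_mul, hσj, hσj, hσw, hψ, hψ, hφw, map_add, map_mul]
  exact IsCMField.of_forall_isConj_of_ne_one hne hconj

end Literature.NumberTheory.NumberFields

end
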